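import Mathlib
import Summits.Ventures.PercRepro2.SepGlueGen

/-!
# Gluing at a general separator, Ia: the real far patterns (blind cell PercRepro2, mine-2 g47,
2026-08-29; `conjectures/MINE-2.md` M2-97)

A far pattern at a separator `σ : ι → V` is a pair `(ι → ι → Bool) × (ι → Bool)`; the ones a
configuration can realise are the connectivity relations of a set partition of `S ∪ {m}`: the
separator part is reflexive, symmetric and transitive, a separator vertex joined to one that the far
side joins to the mark is joined to the mark, and two separator vertices joined to the mark are
joined (`FPrealG`; `fpG_real`).  The far-pattern count of a triple with an unreal component
vanishes (`farCountG_eq_zero_of_not_real`), so the rules of the sequel may quantify their orbit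
hypothesis over the real triples — `Bell(|ι| + 1)` patterns per copy — instead of over the realised
ones.  Own work; standard axioms.
-/

namespace Summit.Ventures.PercRepro2

open UnionCluster

namespace CovForm

namespace RootBridge

open OneTyped TypedA3 Untouched TypedFactor Separated

section Real

open Classical

variable {V : Type*} {E : Type*} {ι : Type*} [Fintype ι] (ends : E → Sym2 V)

/-- A far pattern is REAL when it is the connectivity of a set partition of the separator vertices
and the far mark. -/
def FPrealG (p : FPG ι) : Prop :=
  (∀ i, p.1 i i = true) ∧ (∀ i j, p.1 i j = true → p.1 j i = true) ∧
    (∀ i j k, p.1 i j = true → p.1 j k = true → p.1 i k = true) ∧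
    (∀ i j, p.1 i j = true → p.2 i = true → p.2 j = true) ∧
    (∀ i j, p.2 i = true → p.2 j = true → p.1 i j = true)

omit [Fintype ι] in
/-- Every far pattern of a configuration is real. -/
lemma fpG_real (σ : ι → V) (m : V) (y : Config E) : FPrealG (fpG ends σ m y) := by
  refine ⟨fun i => ?_, fun i j h => ?_, fun i j k h1 h2 => ?_, fun i j h1 h2 => ?_,
    fun i j h1 h2 => ?_⟩
  · simp only [fpG, decide_eq_true_eq]
    exact conn_refl _ _ _
  · simp only [fpG, decide_eq_true_eq] at h ⊢
    exact conn_symm h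
  · simp only [fpG, decide_eq_true_eq] at h1 h2 ⊢
    exact conn_trans h1 h2
  · simp only [fpG, decide_eq_true_eq] at h1 h2 ⊢
    exact conn_trans (conn_symm h1) h2
  · simp only [fpG, decide_eq_true_eq] at h1 h2 ⊢
    exact conn_trans h1 (conn_symm h2)

/-- An unreal pattern never matches a real one. -/
lemma exactG_of_not_real {p q : FPG ι} (hp : ¬ FPrealG p) (hq : FPrealG q) : exactG p q = 0 := by
  unfold exactG
  rw [if_neg]
  rintro rfl
  exact hp hq

end Real

section RealCounts

open Classical

variable {V : Type*} {E : Type*} {ι : Type*} [Fintype ι] [Fintype E] [DecidableEq E] {R : Type*}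
  [Field R]
variable (ends : E → Sym2 V) (σ : ι → V) (m : V) (VL : Set V)

/-- The far-pattern count of a triple with an unreal component vanishes. -/
lemma farCountG_eq_zero_of_not_real (A : Finset E) (z : Config E) (τ : E → ℕ) (p : Pat3G ι)
    (hp : ¬ FPrealG p.1 ∨ ¬ FPrealG p.2.1 ∨ ¬ FPrealG p.2.2) :
    typedCount A z τ (farKG ends σ m VL p : Config E → Config E → Config E → R) = 0 := by
  rw [← typedCount_zero_kernel A z τ]
  refine typedCount_congr' _ _ _ _ _ fun x y w => ?_
  unfold farKG
  rcases hp with hp | hp | hp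
  · rw [exactG_of_not_real hp (fpG_real ends σ m _)]
    simp
  · rw [exactG_of_not_real hp (fpG_real ends σ m _)]
    simp
  · rw [exactG_of_not_real hp (fpG_real ends σ m _)]
    simp

/-- A triple with a nonzero far-pattern count has real components. -/
lemma real_of_farCountG_ne_zero (A : Finset E) (z : Config E) (τ : E → ℕ) (p : Pat3G ι)
    (h : typedCount A z τ (farKG ends σ m VL p : Config E → Config E → Config E → R) ≠ 0) :
    FPrealG p.1 ∧ FPrealG p.2.1 ∧ FPrealG p.2.2 := by
  by_contra hc
  refine h (farCountG_eq_zero_of_not_real ends σ m VL A z τ p ?_)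
  by_cases h1 : FPrealG p.1
  · by_cases h2 : FPrealG p.2.1
    · by_cases h3 : FPrealG p.2.2
      · exact absurd ⟨h1, h2, h3⟩ hc
      · exact Or.inr (Or.inr h3)
    · exact Or.inr (Or.inl h2)
  · exact Or.inl h1

end RealCounts

end RootBridge

end CovForm

end Summit.Ventures.PercRepro2
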